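import Summits.Ventures.PackingBounds.ThreePointCert.G27CertC

/-!
# A(10, arccos 1/10) ≤ 26: kernel instance of the exact value-27 three-point certificate — kernel validation of the pre-multiplied summands of (ii)

Framing: lottery ticket; floor = certified bounds/negative ranges. Venture `PackingBounds` (cell
`pub-packcert`), recognition seat (T5: the ghost `srg(27, 20, 29/2, 15)`), three-point SDP family's exact
kernel format. Integer data of an EXACT (slack-free) Bachoc–Vallentin certificate of value exactly `27` for
`A(10, arccos 1/10)` (n = 10, s = 1/10, degree 6, symmetric sums of squares of Machado–de Oliveira Filho
type, `B = 0`; every block on the optimal face complementary to the ghost pseudo-configuration), produced by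
`pub-packcert-recog` gen 16 (`code/t5/kernel/job3.py` + `job4b.py`, the latter = `pub-packcert-lp` gen 4's
`job4.py` adapted) in the units of the kernel checker `ThreePointCert.CheckExact` (soundness
`ThreePointCert.SoundExact*`, built by `pub-packcert-lp` gen 4 for `A(9, arccos 1/3) ≤ 98`). Generated file:
plain lists of integers / monomials.
-/

namespace Summit.Ventures.PackingBounds.ThreePointCert.G27

open Literature.Geometry.DiscreteGeometry Literature.Geometry.DiscreteGeometry.PolyCert PolyCert.SPoly

set_option maxHeartbeats 0 in
/-- Pre-multiplied summand 1 of (ii) (kernel). -/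
theorem okM_1 : mulOK (m1P 1 10) 4674745995884780175360000000000000 G27.eTOT1 G27.eP1 = true := by
  decide +kernel

set_option maxHeartbeats 0 in
/-- Pre-multiplied summand 2 of (ii) (kernel). -/
theorem okM_2 : mulOK (m2P 1 10) 467474599588478017536000000000000 G27.eTOT2 G27.eP2 = true := by
  decide +kernel

set_option maxHeartbeats 0 in
/-- Pre-multiplied summand 3 of (ii) (kernel). -/
theorem okM_3 : mulOK (m3P 1 10) 46747459958847801753600000000000 G27.eTOT3 G27.eP3 = true := by
  decide +kernel

set_option maxHeartbeats 0 in
/-- Pre-multiplied summand 4 of (ii) (kernel). -/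
theorem okM_4 : mulOK p4 46747459958847801753600000000000000 G27.eTOT4 G27.eP4 = true := by
  decide +kernel

end Summit.Ventures.PackingBounds.ThreePointCert.G27
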